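import Mathlib
import Literature.NumberTheory.PAdicHodge.FontaineDpst
import Literature.NumberTheory.PAdicHodge.CrystallineBaseChange
import Literature.NumberTheory.PAdicHodge.FontainePstLabelledWeightsSchemata
import Literature.NumberTheory.PAdicHodge.LabelledHodgeTateWeightsBaseChangeLabelwise
import Literature.NumberTheory.GaloisRepresentations.ToLocalRestrictField
import Literature.NumberTheory.GaloisRepresentations.RestrictFieldSelf
import Literature.NumberTheory.GaloisRepresentations.AbsGaloisOuterConj
import Literature.NumberTheory.GaloisRepresentations.PstCrystallineExtensionData
import Literature.NumberTheory.GaloisRepresentations.PotentialDiagonalizability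
import Literature.NumberTheory.GaloisRepresentations.PadicAlgebraDegreeOnePlace
import Literature.NumberTheory.Automorphic.GaloisActionPlaces
import HarnessLib

/-!
# FontainePstKroneckerSchemata

Topic `Literature/NumberTheory/PAdicHodge`. Named literature fact(s) relocated by the gate from `Summits/Langlands/Langlands/Theorems/NonParallelVoidTensorSquareParallelStubTensorLocalCrystalline.lean`
(accept-time relocation of `[cite]`d propositions written inline in a Summits proposal; human ruling 2026-08-15).
Sources: BarnetlambEtAl2014, BrinonConrad2009, FontaineAsterisque223III.

* `Literature.NumberTheory.PAdicHodge.KroneckerCrystallineSchema`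
* `Literature.NumberTheory.PAdicHodge.KroneckerLabelledWeightsSchema`
-/

namespace Literature.NumberTheory.PAdicHodge

open scoped NumberField Kronecker
open IsDedekindDomain Field ValuativeRel
open Literature.NumberTheory.GaloisRepresentations Literature.NumberTheory.PAdicHodge

/-- **Crystalline representations are stable under tensor product, for THE pinned Fontaine
datum** (`fontainePst K ℓ hK`, file `FontaineDpst`).  Fontaine: the `B_cris`-admissible
(= crystalline) representations of `Γ_K` form a sub-Tannakian category of `Rep_{ℚ_ℓ}(Γ_K)`, stable
under tensor products and duals, on which `D_cris` is an exact faithful ⊗-functor (Fontaine 1994,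
Exp. III §1.5 — the formalism of `B`-admissible representations for a `(ℚ_ℓ, G_K)`-regular `B` —
with §5.1 for `B_cris`; Brinon–Conrad 2009 §9.1, Prop. 9.1.9 and Prop. 9.1.11; Caruso 2019,
Def. 1.4.2 and §4.3).  In the `D_pst` phrasing behind `IsCrystallineFramed` (de Rham with
`WD ∘ D_pst` unramified and `N = 0`, Fontaine Exp. VIII §2.3.7) this reads: `D_pst` is a ⊗-functor,
`N_{V⊗W} = N_V ⊗ 1 + 1 ⊗ N_W`, and the inertia action on `D_pst(V ⊗ W) = D_pst(V) ⊗ D_pst(W)` is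
the diagonal one.  Tree form, in frames (NAMED FACT, D-0014): for an `ℓ`-adic local field `K`
(`hK : |ℓ|_K < 1`), framed `ρ₁ : Γ_K →ₜ* GL_n(ℚ̄_ℓ)`, `ρ₂ : Γ_K →ₜ* GL_m(ℚ̄_ℓ)` and a framed
`ρ : Γ_K →ₜ* GL_k(ℚ̄_ℓ)` which IS their Kronecker product in the product basis enumerated by
`e : Fin n × Fin m ≃ Fin k` (`ρ(σ) = e_*(ρ₁(σ) ⊗ₖ ρ₂(σ))`, Mathlib `Matrix.kroneckerMap` and
`Matrix.reindex`; so `k = nm`), if `ρ₁` and `ρ₂` are crystalline for `fontainePst K ℓ hK` then so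
is `ρ`.  Like the accepted siblings `CrystallineBaseChange` and `LabelledWeightsTwistSchema` this
is a theorem for Fontaine's CONSTRUCTION and is not derivable for the ε-pinned term from the
clauses (F1)–(F14) of `IsFontaineDatum` (no clause concerns tensor products); it becomes a
theorem-by-construction at step D2 of the Upgrade path of `FontaineDpst`.  Wanted by crux
`stmt-Langlands-17009` (`NonParallelVoid.TensorSquareParallel`, line `merged`, stub
`stub_tensorInductionLocal`: the local clause (T3) of Calegari's tensor induction
`⊗-Ind_{Γ_F}^{Γ_ℚ} ρ`, Calegari 2010 §2).
-- TODO(general form): the identity `D_cris(V ⊗ W) = D_cris(V) ⊗ D_cris(W)` of filtered `φ`-modules itself.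
[cite: FontaineAsterisque223III, Exp. III §1.5 and §5.1]
[cite: BrinonConrad2009, §9.1, Prop. 9.1.9 and Prop. 9.1.11]
[file NumberTheory/PAdicHodge/FontainePstKroneckerSchemata] -/
def KroneckerCrystallineSchema : Prop :=
  ∀ (ℓ : ℕ) [Fact ℓ.Prime] (K : Type) [Field K] [ValuativeRel K] [TopologicalSpace K]
    [IsNonarchimedeanLocalField K] [CharZero K] (hK : valuation K (ℓ : K) < 1) (n m k : ℕ)
    (e : Fin n × Fin m ≃ Fin k)
    (ρ₁ : FramedRep (absoluteGaloisGroup K) (PadicAlgCl ℓ) n)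
    (ρ₂ : FramedRep (absoluteGaloisGroup K) (PadicAlgCl ℓ) m)
    (ρ : FramedRep (absoluteGaloisGroup K) (PadicAlgCl ℓ) k),
    (∀ σ, (ρ σ).val = Matrix.reindex e e ((ρ₁ σ).val ⊗ₖ (ρ₂ σ).val)) →
    (fontainePst K ℓ hK).IsCrystallineFramed ρ₁ → (fontainePst K ℓ hK).IsCrystallineFramed ρ₂ →
      (fontainePst K ℓ hK).IsCrystallineFramed ρ

/-- **Labelled Hodge–Tate weights of a tensor product of de Rham representations are the
pairwise sums, for THE pinned Fontaine datum** (`fontainePst K ℓ hK`).  Fontaine: on de Rham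
objects `D_dR` is an exact faithful ⊗-functor to filtered `K`-vector spaces,
`D_dR(V ⊗ W) = D_dR(V) ⊗_K D_dR(W)` with the product filtration (Fontaine 1994, Exp. III §1.5;
Brinon–Conrad 2009 §6.3), so that on `τ`-components
`gr(D_dR(V ⊗ W) ⊗_{K,τ} ℚ̄_ℓ) = ⊕_{i+j} gr^i(V)_τ ⊗ gr^j(W)_τ` and
`HT_τ(V ⊗ W) = {h + h' : h ∈ HT_τ(V), h' ∈ HT_τ(W)}` with multiplicities (the computation
behind the regularity of the tensor products formed in [BLGGT] §1.4, remark (5), and in Calegari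
2010 §2).  Tree form, in frames (NAMED FACT, D-0014): for
`K`, `hK`, `e`, `ρ₁`, `ρ₂` and their Kronecker product `ρ` as in `KroneckerCrystallineSchema`, if
`ρ₁` and `ρ₂` are de Rham for `fontainePst K ℓ hK` then for every label `τ : K →ₐ[ℚ_ℓ] ℚ̄_ℓ`
(pinned `ℚ_ℓ`-structure) the `τ`-labelled multiset of `ρ` relative to
`(fontainePst K ℓ hK).𝔅 = B_dR(K)` is `(HT_τ ρ₁).bind (fun a ↦ (HT_τ ρ₂).map (a + ·))`.  The de
Rham hypotheses are those of the printed statement (for non-Hodge–Tate factors the inclusion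
`gr D(V) ⊗ gr D(W) ⊆ gr D(V ⊗ W)` can be strict); the rank-one case `ρ₂ = χ · 1` is the accepted
`LabelledWeightsTwistSchema`, and `χ = ε^m` is PROVED in the tree
(`labelledHodgeTateWeightsAt_twist_of_cyclotomic_zpow`).  Not derivable for the ε-pinned term from
(F1)–(F14); a theorem-by-construction at step D2 of the Upgrade path.  Wanted by crux
`stmt-Langlands-17009`, stub `stub_tensorInductionLocal` (four distinct weights
`{a+a', a+b', b+a', b+b'}` of `⊗-Ind ρ` when `b − a ≠ b' − a'`, Calegari 2010 §2).
-- TODO(general form): the filtered isomorphism `D_dR(V ⊗ W) ≅ D_dR(V) ⊗_K D_dR(W)` itself.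
[cite: FontaineAsterisque223III, Exp. III §1.5] [cite: BrinonConrad2009, §6.3]
[cite: BarnetlambEtAl2014, §1.4]
[file NumberTheory/PAdicHodge/FontainePstKroneckerSchemata] -/
def KroneckerLabelledWeightsSchema : Prop :=
  ∀ (ℓ : ℕ) [Fact ℓ.Prime] (K : Type) [Field K] [ValuativeRel K] [TopologicalSpace K]
    [IsNonarchimedeanLocalField K] [CharZero K] (hK : valuation K (ℓ : K) < 1) (n m k : ℕ)
    (e : Fin n × Fin m ≃ Fin k)
    (ρ₁ : FramedRep (absoluteGaloisGroup K) (PadicAlgCl ℓ) n)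
    (ρ₂ : FramedRep (absoluteGaloisGroup K) (PadicAlgCl ℓ) m)
    (ρ : FramedRep (absoluteGaloisGroup K) (PadicAlgCl ℓ) k),
    (∀ σ, (ρ σ).val = Matrix.reindex e e ((ρ₁ σ).val ⊗ₖ (ρ₂ σ).val)) →
    (fontainePst K ℓ hK).IsDeRhamFramed ρ₁ → (fontainePst K ℓ hK).IsDeRhamFramed ρ₂ →
    letI := (fontainePst K ℓ hK).algebra
    ∀ τ : K →ₐ[ℚ_[ℓ]] PadicAlgCl ℓ,
      (fontainePst K ℓ hK).𝔅.labelledHodgeTateWeights (FramedRep.toContinuousRep ρ) τ.toRingHom =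
        ((fontainePst K ℓ hK).𝔅.labelledHodgeTateWeights (FramedRep.toContinuousRep ρ₁)
            τ.toRingHom).bind fun a =>
          ((fontainePst K ℓ hK).𝔅.labelledHodgeTateWeights (FramedRep.toContinuousRep ρ₂)
            τ.toRingHom).map fun b => a + b

/-! ### (2a): the re-typed stub, proved from the named facts -/

end Literature.NumberTheory.PAdicHodge
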